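import Mathlib

/-!
# Crux `ChessboardParticlePlanes.LjBilayerHcp` (stmt-AtomisticToContinuum-6710), line `Sketch`,
# stub N5 `stub_powerSum_tail` — an explicit tail bound for the hcp power sum `P₃`

For the planar form `Q(k,i,j) = i² + ij + j² + [k odd](i + j + 1/3) ≥ 0` (squared horizontal
offset of the hcp site `(k,i,j)` at unit spacing) and `t > 0`, the sum of `(Q v + k²t²)⁻³` over
the sites `v = (k,i,j) ≠ 0` OUTSIDE an index box `|k| ≤ K`, `|i|, |j| ≤ N` (`K, N ≥ 1`) is at
most `∑_{|k| ≤ K} 4608 / (5((3N-2)² + 12k²t²)²) + 64/(15K³t⁴) + 18/(5K⁵t⁶)`.  [folklore]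

PROOF (elementary, all terms are `≥ 0`).  It suffices to bound every finite partial sum
(`Real.tsum_le_of_sum_le`); a finite set of sites lies in a big box `|k| ≤ K'`, `|i|,|j| ≤ M`,
whose sum is organised by layers `k` and square rings `max(|i|,|j|) = m`:
* the ring `m ≥ 1` has `8m` sites and on it `Q ≥ (3m-2)²/12` (both parities), so each of its
  terms in layer `k` is `≤ 1728 / ((3m-2)² + 12k²t²)³` (`powerSumTail_ring_lb`);
* `8m·1728/((3m-2)²+D)³ ≤ F(m-1) - F(m)` with `F(x) = 4608/(5((3x-2)²+D)²)` for `m ≥ 2`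
  (`powerSumTail_tele_ring`), so the rings `m > M₀ ≥ 1` of a layer contribute `≤ F(M₀)`
  (`powerSumTail_sum_square`);
* layers `|k| ≤ K` (rings `m > N`) give the first summand; a layer `|k| > K` is bounded by
  `9/(k⁶t⁶)` (the `9` sites with `m ≤ 1`, using `Q ≥ 0`) plus `F(1) ≤ 32/(5k⁴t⁴)`, and
  `∑_{k>K} k⁻⁴ ≤ 1/(3K³)`, `∑_{k>K} k⁻⁶ ≤ 1/(5K⁵)` telescope (`powerSumTail_sum_layers`).
-/

noncomputable section

open scoped BigOperators

namespace Summit.AtomisticToContinuum.Crystallization.Theorems.LjBilayerHcpSketch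

/-! ## One-dimensional telescoping inequalities -/

/-- Telescoping step for the ring sums: for real `m ≥ 1` and `D ≥ 0`,
`8(m+1)·1728/((3(m+1)-2)² + D)³ ≤ F(m) - F(m+1)`, `F(x) = 4608/(5((3x-2)² + D)²)`. [folklore] -/
theorem powerSumTail_tele_ring (m D : ℝ) (hm : 1 ≤ m) (hD : 0 ≤ D) :
    8 * (m + 1) * (1728 / ((3 * (m + 1) - 2) ^ 2 + D) ^ 3) ≤
      4608 / (5 * ((3 * m - 2) ^ 2 + D) ^ 2) - 4608 / (5 * ((3 * (m + 1) - 2) ^ 2 + D) ^ 2) := by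
  have ha' : 0 < (3 * m - 2) ^ 2 + D := by nlinarith
  have hle : (3 * m - 2) ^ 2 + D ≤ (3 * (m + 1) - 2) ^ 2 + D := by nlinarith
  have ha : 0 < (3 * (m + 1) - 2) ^ 2 + D := lt_of_lt_of_le ha' hle
  set a := (3 * (m + 1) - 2) ^ 2 + D with ha_def
  set a' := (3 * m - 2) ^ 2 + D with ha'_def
  have hdiff : a - a' = 18 * m - 3 := by rw [ha_def, ha'_def]; ring
  have key : 15 * (m + 1) * a' ^ 2 ≤ (a ^ 2 - a' ^ 2) * a := by
    have h1 : (a ^ 2 - a' ^ 2) * a = (18 * m - 3) * (a + a') * a := by rw [← hdiff]; ring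
    have h2 : 0 ≤ (18 * m - 3) * ((a - a') * (a + 2 * a')) :=
      mul_nonneg (by linarith) (mul_nonneg (sub_nonneg.2 hle) (by positivity))
    nlinarith [h1, h2, mul_nonneg (sub_nonneg.2 hm) (sq_nonneg a')]
  rw [← sub_nonneg]
  have e : 4608 / (5 * a' ^ 2) - 4608 / (5 * a ^ 2) - 8 * (m + 1) * (1728 / a ^ 3) =
      4608 * ((a ^ 2 - a' ^ 2) * a - 15 * (m + 1) * a' ^ 2) / (5 * a' ^ 2 * a ^ 3) := by
    field_simp
    ring
  rw [e]
  exact div_nonneg (mul_nonneg (by norm_num) (by linarith)) (by positivity)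

/-- `1/(n+1)⁴ ≤ (1/3)(1/n³ - 1/(n+1)³)` for real `n ≥ 1` (the numerator of the difference is
`6n² + 4n + 1 > 0`). [folklore] -/
theorem powerSumTail_tele_four (n : ℝ) (hn : 1 ≤ n) :
    1 / (n + 1) ^ 4 ≤ 1 / 3 * (1 / n ^ 3 - 1 / (n + 1) ^ 3) := by
  have hn0 : 0 < n := by linarith
  have hn1 : 0 < n + 1 := by linarith
  rw [← sub_nonneg]
  have e : 1 / 3 * (1 / n ^ 3 - 1 / (n + 1) ^ 3) - 1 / (n + 1) ^ 4 =
      (6 * n ^ 2 + 4 * n + 1) / (3 * n ^ 3 * (n + 1) ^ 4) := by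
    field_simp
    ring
  rw [e]; positivity

/-- `1/(n+1)⁶ ≤ (1/5)(1/n⁵ - 1/(n+1)⁵)` for real `n ≥ 1` (the numerator of the difference is
`15n⁴ + 20n³ + 15n² + 6n + 1 > 0`). [folklore] -/
theorem powerSumTail_tele_six (n : ℝ) (hn : 1 ≤ n) :
    1 / (n + 1) ^ 6 ≤ 1 / 5 * (1 / n ^ 5 - 1 / (n + 1) ^ 5) := by
  have hn0 : 0 < n := by linarith
  have hn1 : 0 < n + 1 := by linarith
  rw [← sub_nonneg]
  have e : 1 / 5 * (1 / n ^ 5 - 1 / (n + 1) ^ 5) - 1 / (n + 1) ^ 6 =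
      (15 * n ^ 4 + 20 * n ^ 3 + 15 * n ^ 2 + 6 * n + 1) / (5 * n ^ 5 * (n + 1) ^ 6) := by
    field_simp
    ring
  rw [e]; positivity

/-! ## Sums over symmetric integer intervals and squares -/

/-- Peeling the two extreme points off a symmetric integer interval:
`∑_{|k| ≤ n+1} g k = ∑_{|k| ≤ n} g k + g (n+1) + g (-(n+1))`. [folklore] -/
theorem powerSumTail_sum_Icc_succ (g : ℤ → ℝ) (n : ℕ) :
    ∑ k ∈ Finset.Icc (-((n : ℤ) + 1)) ((n : ℤ) + 1), g k =
      ∑ k ∈ Finset.Icc (-(n : ℤ)) n, g k + g ((n : ℤ) + 1) + g (-((n : ℤ) + 1)) := by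
  have h : Finset.Icc (-((n : ℤ) + 1)) ((n : ℤ) + 1) =
      Finset.Icc (-(n : ℤ)) n ∪ {(n : ℤ) + 1, -((n : ℤ) + 1)} := by
    ext x
    simp only [Finset.mem_union, Finset.mem_Icc, Finset.mem_insert, Finset.mem_singleton]
    omega
  have hd : Disjoint (Finset.Icc (-(n : ℤ)) n) {(n : ℤ) + 1, -((n : ℤ) + 1)} := by
    rw [Finset.disjoint_left]
    intro x hx hx'
    simp only [Finset.mem_Icc] at hx
    simp only [Finset.mem_insert, Finset.mem_singleton] at hx'
    omega
  rw [h, Finset.sum_union hd, Finset.sum_pair (by omega), add_assoc]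

/-- Layer summation.  If `g k ≤ B k` for `|k| ≤ K` and `g k ≤ c₆/k⁶ + c₄/k⁴` for `|k| > K ≥ 1`
(`c₄, c₆ ≥ 0`), then `∑_{|k| ≤ K'} g k ≤ ∑_{|k| ≤ K} B k + (2/3)c₄/K³ + (2/5)c₆/K⁵` for every
`K' ≥ K` (both signs of `k`; `∑_{k>K} k⁻⁴ ≤ 1/(3K³)`, `∑_{k>K} k⁻⁶ ≤ 1/(5K⁵)`). [folklore] -/
theorem powerSumTail_sum_layers (g B : ℤ → ℝ) (c₄ c₆ : ℝ) (hc₄ : 0 ≤ c₄) (hc₆ : 0 ≤ c₆)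
    (K : ℕ) (hK : 1 ≤ K) (h1 : ∀ k : ℤ, |k| ≤ (K : ℤ) → g k ≤ B k)
    (h2 : ∀ k : ℤ, (K : ℤ) < |k| → g k ≤ c₆ * (1 / (k : ℝ) ^ 6) + c₄ * (1 / (k : ℝ) ^ 4))
    (K' : ℕ) (hK' : K ≤ K') :
    ∑ k ∈ Finset.Icc (-(K' : ℤ)) K', g k ≤
      ∑ k ∈ Finset.Icc (-(K : ℤ)) K, B k + 2 / 3 * c₄ * (1 / (K : ℝ) ^ 3) +
        2 / 5 * c₆ * (1 / (K : ℝ) ^ 5) := by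
  suffices H : ∑ k ∈ Finset.Icc (-(K' : ℤ)) K', g k ≤
      ∑ k ∈ Finset.Icc (-(K : ℤ)) K, B k + 2 / 3 * c₄ * (1 / (K : ℝ) ^ 3 - 1 / (K' : ℝ) ^ 3) +
        2 / 5 * c₆ * (1 / (K : ℝ) ^ 5 - 1 / (K' : ℝ) ^ 5) by
    have h4 : 0 ≤ c₄ * (1 / (K' : ℝ) ^ 3) := by positivity
    have h6 : 0 ≤ c₆ * (1 / (K' : ℝ) ^ 5) := by positivity
    linarith
  induction K', hK' using Nat.le_induction with
  | base =>
    have : ∑ k ∈ Finset.Icc (-(K : ℤ)) K, g k ≤ ∑ k ∈ Finset.Icc (-(K : ℤ)) K, B k := by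
      refine Finset.sum_le_sum fun k hk => h1 k (abs_le.2 ?_)
      simpa only [Finset.mem_Icc] using hk
    linarith
  | succ n hn ih =>
    push_cast
    rw [powerSumTail_sum_Icc_succ]
    have hn1 : (1 : ℝ) ≤ n := by exact_mod_cast hK.trans hn
    have hpos : (K : ℤ) < |(n : ℤ) + 1| := by
      rw [abs_of_nonneg (by positivity)]; exact_mod_cast Nat.lt_succ_of_le hn
    have g1 := h2 _ hpos
    have g2 := h2 _ (by rwa [abs_neg])
    push_cast at g1 g2
    rw [show (-((n : ℝ) + 1)) ^ 6 = ((n : ℝ) + 1) ^ 6 by ring,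
      show (-((n : ℝ) + 1)) ^ 4 = ((n : ℝ) + 1) ^ 4 by ring] at g2
    have t4 := mul_le_mul_of_nonneg_left (powerSumTail_tele_four (n : ℝ) hn1) hc₄
    have t6 := mul_le_mul_of_nonneg_left (powerSumTail_tele_six (n : ℝ) hn1) hc₆
    linarith

/-- Ring summation over squares.  If `∑_{|i|,|j| ≤ M₀} φ ≤ C` (`M₀ ≥ 1`) and on every ring
`max(|i|,|j|) = m+1`, `m ≥ M₀`, one has `φ ≤ 1728/((3(m+1)-2)² + D)³` (`D ≥ 0`), then
`∑_{|i|,|j| ≤ M} φ ≤ C + 4608/(5((3M₀-2)² + D)²)` for all `M ≥ M₀`: the ring has `8(m+1)`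
points and the bound telescopes (`powerSumTail_tele_ring`). [folklore] -/
theorem powerSumTail_sum_square (φ : ℤ × ℤ → ℝ) (D C : ℝ) (hD : 0 ≤ D) (M₀ : ℕ)
    (hM₀ : 1 ≤ M₀) (h0 : ∑ p ∈ Finset.Icc (-(M₀ : ℤ)) M₀ ×ˢ Finset.Icc (-(M₀ : ℤ)) M₀, φ p ≤ C)
    (hring : ∀ m : ℕ, M₀ ≤ m → ∀ p : ℤ × ℤ, |p.1| ≤ (m : ℤ) + 1 → |p.2| ≤ (m : ℤ) + 1 →
      ((m : ℤ) + 1 ≤ |p.1| ∨ (m : ℤ) + 1 ≤ |p.2|) →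
      φ p ≤ 1728 / ((3 * ((m : ℝ) + 1) - 2) ^ 2 + D) ^ 3)
    (M : ℕ) (hM : M₀ ≤ M) :
    ∑ p ∈ Finset.Icc (-(M : ℤ)) M ×ˢ Finset.Icc (-(M : ℤ)) M, φ p ≤
      C + 4608 / (5 * ((3 * (M₀ : ℝ) - 2) ^ 2 + D) ^ 2) := by
  suffices H : ∑ p ∈ Finset.Icc (-(M : ℤ)) M ×ˢ Finset.Icc (-(M : ℤ)) M, φ p ≤
      C + 4608 / (5 * ((3 * (M₀ : ℝ) - 2) ^ 2 + D) ^ 2)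
        - 4608 / (5 * ((3 * (M : ℝ) - 2) ^ 2 + D) ^ 2) by
    have : 0 ≤ 4608 / (5 * ((3 * (M : ℝ) - 2) ^ 2 + D) ^ 2) := by positivity
    linarith
  induction M, hM using Nat.le_induction with
  | base => linarith
  | succ M hMM ih =>
    push_cast
    set big := Finset.Icc (-((M : ℤ) + 1)) ((M : ℤ) + 1) ×ˢ
      Finset.Icc (-((M : ℤ) + 1)) ((M : ℤ) + 1) with hbig
    set small := Finset.Icc (-(M : ℤ)) M ×ˢ Finset.Icc (-(M : ℤ)) M with hsmall
    have hsub : small ⊆ big :=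
      Finset.product_subset_product (Finset.Icc_subset_Icc (by linarith) (by linarith))
        (Finset.Icc_subset_Icc (by linarith) (by linarith))
    have hb : ∀ p ∈ big \ small, φ p ≤ 1728 / ((3 * ((M : ℝ) + 1) - 2) ^ 2 + D) ^ 3 := by
      intro p hp
      simp only [hbig, hsmall, Finset.mem_sdiff, Finset.mem_product, Finset.mem_Icc] at hp
      refine hring M hMM p (abs_le.2 ⟨hp.1.1.1, hp.1.1.2⟩) (abs_le.2 ⟨hp.1.2.1, hp.1.2.2⟩) ?_
      rw [le_abs, le_abs]
      omega
    have hcard : ((big \ small).card : ℝ) = 8 * ((M : ℝ) + 1) := by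
      have e1 : ((M : ℤ) + 1 - -(M : ℤ)).toNat = 2 * M + 1 := by omega
      have e2 : ((M : ℤ) + 1 + 1 - -((M : ℤ) + 1)).toNat = 2 * M + 3 := by omega
      have hs : small.card = (2 * M + 1) * (2 * M + 1) := by
        rw [hsmall, Finset.card_product, Int.card_Icc, e1]
      have hb' : big.card = (2 * M + 3) * (2 * M + 3) := by
        rw [hbig, Finset.card_product, Int.card_Icc, e2]
      have h1 := Finset.card_sdiff_add_card_eq_card hsub
      rw [hs, hb'] at h1
      have h2 : ((big \ small).card : ℝ) + ((2 * M + 1) * (2 * M + 1) : ℕ) =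
          ((2 * M + 3) * (2 * M + 3) : ℕ) := by
        exact_mod_cast h1
      push_cast at h2
      linarith
    rw [← Finset.sum_sdiff hsub]
    have hsum := Finset.sum_le_card_nsmul _ _ _ hb
    rw [nsmul_eq_mul, hcard] at hsum
    have htele := powerSumTail_tele_ring (M : ℝ) D (by exact_mod_cast hM₀.trans hMM) hD
    linarith [hsum, htele, ih]

/-! ## The ring lower bound for the planar form -/

/-- On the ring `max(|i|,|j|) = m+1` both parities of the planar form are `≥ (3(m+1)-2)²/12`:
`i² + ij + j² ≥ (3/4)(m+1)²`, and e.g. for `i = m+1 ≥ |j|` the odd-layer difference is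
`(i/2 + j)² + 2i + j ≥ 0`, for `i = -(m+1)` it is `(i/2 - j)² + j ≥ 0` using `j² + j ≥ 0` for
integers; symmetric in `i ↔ j`. [folklore] -/
theorem powerSumTail_ring_lb (i j : ℤ) (m : ℕ) (hi : |i| ≤ (m : ℤ) + 1) (hj : |j| ≤ (m : ℤ) + 1)
    (h : (m : ℤ) + 1 ≤ |i| ∨ (m : ℤ) + 1 ≤ |j|) :
    (3 * ((m : ℝ) + 1) - 2) ^ 2 / 12 ≤ (i : ℝ) ^ 2 + (i : ℝ) * j + (j : ℝ) ^ 2 ∧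
    (3 * ((m : ℝ) + 1) - 2) ^ 2 / 12 ≤
      (i : ℝ) ^ 2 + (i : ℝ) * j + (j : ℝ) ^ 2 + ((i : ℝ) + j + 1 / 3) := by
  rw [abs_le] at hi hj
  rw [le_abs, le_abs] at h
  have hm : (0 : ℝ) ≤ m := Nat.cast_nonneg m
  have hsq : ∀ x : ℤ, (0 : ℝ) ≤ (x : ℝ) * x + x := by
    intro x
    have hx : (0 : ℤ) ≤ x * x + x := by
      rcases le_or_gt 0 x with h0 | h0
      · nlinarith
      · nlinarith [mul_nonneg (neg_nonneg.2 h0.le) (neg_nonneg.2 (by omega : x + 1 ≤ 0))]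
    exact_mod_cast hx
  have hi1 : -((m : ℝ) + 1) ≤ i := by exact_mod_cast hi.1
  have hj1 : -((m : ℝ) + 1) ≤ j := by exact_mod_cast hj.1
  have hcases : i = (m : ℤ) + 1 ∨ i = -((m : ℤ) + 1) ∨ j = (m : ℤ) + 1 ∨ j = -((m : ℤ) + 1) := by
    omega
  rcases hcases with hc | hc | hc | hc
  · have hcR : (i : ℝ) = (m : ℝ) + 1 := by exact_mod_cast hc
    rw [hcR]
    constructor <;> nlinarith [sq_nonneg (((m : ℝ) + 1) / 2 + j)]
  · have hcR : (i : ℝ) = -((m : ℝ) + 1) := by exact_mod_cast hc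
    rw [hcR]
    refine ⟨by nlinarith [sq_nonneg (((m : ℝ) + 1) / 2 - j)], ?_⟩
    rcases le_or_gt 0 (j : ℝ) with h0 | h0
    · nlinarith [sq_nonneg (((m : ℝ) + 1) / 2 - j)]
    · nlinarith [mul_nonneg (by linarith : (0 : ℝ) ≤ (m : ℝ) + 1) (neg_nonneg.2 h0.le),
        sq_nonneg ((m : ℝ) + 1), hsq j]
  · have hcR : (j : ℝ) = (m : ℝ) + 1 := by exact_mod_cast hc
    rw [hcR]
    constructor <;> nlinarith [sq_nonneg (((m : ℝ) + 1) / 2 + i)]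
  · have hcR : (j : ℝ) = -((m : ℝ) + 1) := by exact_mod_cast hc
    rw [hcR]
    refine ⟨by nlinarith [sq_nonneg (((m : ℝ) + 1) / 2 - i)], ?_⟩
    rcases le_or_gt 0 (i : ℝ) with h0 | h0
    · nlinarith [sq_nonneg (((m : ℝ) + 1) / 2 - i)]
    · nlinarith [mul_nonneg (by linarith : (0 : ℝ) ≤ (m : ℝ) + 1) (neg_nonneg.2 h0.le),
        sq_nonneg ((m : ℝ) + 1), hsq i]

/-! ## Pointwise bound for the summand and assembly -/

/-- The summand `[¬ box] · [v ≠ 0] · ((1²·q + D)⁻¹)³` is at most `1/(L + D)³` whenever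
`L ≤ q` and `L + D > 0`. [folklore] -/
theorem powerSumTail_pt (q D L : ℝ) (P Z : Prop) {hP : Decidable P} {hZ : Decidable Z}
    (hLq : L ≤ q) (hpos : 0 < L + D) :
    (if P then (0 : ℝ) else if Z then (0 : ℝ) else (((1 : ℝ) ^ 2 * q + D)⁻¹) ^ 3) ≤
      1 / (L + D) ^ 3 := by
  split_ifs
  · positivity
  · positivity
  · rw [one_pow, one_mul, inv_pow, ← one_div]
    apply one_div_le_one_div_of_le (pow_pos hpos 3)
    exact pow_le_pow_left₀ hpos.le (by linarith) 3

/-- Assembly of the tail bound from four properties of a summand `f ≥ 0` on `ℤ³`: it vanishes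
on the box `|k| ≤ K, |i|,|j| ≤ N`, it is `≤ 1728/((3(m+1)-2)² + 12k²t²)³` on the ring
`max(|i|,|j|) = m+1` of layer `k`, and `≤ (k²t²)⁻³` everywhere on a layer `k ≠ 0`.  Then every
finite partial sum of `f` is below the stated tail bound. [folklore] -/
theorem powerSumTail_of_bounds (f : ℤ × ℤ × ℤ → ℝ) (t : ℝ) (K N : ℕ) (ht : 0 < t) (hK : 1 ≤ K)
    (hN : 1 ≤ N) (hf0 : ∀ v, 0 ≤ f v)
    (hbox : ∀ v, |v.1| ≤ (K : ℤ) → |v.2.1| ≤ (N : ℤ) → |v.2.2| ≤ (N : ℤ) → f v = 0)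
    (hring : ∀ (k : ℤ) (m : ℕ) (p : ℤ × ℤ), |p.1| ≤ (m : ℤ) + 1 → |p.2| ≤ (m : ℤ) + 1 →
      ((m : ℤ) + 1 ≤ |p.1| ∨ (m : ℤ) + 1 ≤ |p.2|) →
      f (k, p) ≤ 1728 / ((3 * ((m : ℝ) + 1) - 2) ^ 2 + 12 * (k : ℝ) ^ 2 * t ^ 2) ^ 3)
    (hcentre : ∀ (k : ℤ) (p : ℤ × ℤ), k ≠ 0 → f (k, p) ≤ 1 / ((k : ℝ) ^ 2 * t ^ 2) ^ 3)
    (S : Finset (ℤ × ℤ × ℤ)) :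
    ∑ v ∈ S, f v ≤
      (∑ k ∈ Finset.Icc (-(K : ℤ)) (K : ℤ),
          (4608 : ℝ) / (5 * ((3 * (N : ℝ) - 2) ^ 2 + 12 * (k : ℝ) ^ 2 * t ^ 2) ^ 2)) +
        64 / (15 * (K : ℝ) ^ 3 * t ^ 4) + 18 / (5 * (K : ℝ) ^ 5 * t ^ 6) := by
  -- a big index box containing `S`
  obtain ⟨K', M, hKK', hNM, hS⟩ : ∃ K' M : ℕ, K ≤ K' ∧ N ≤ M ∧
      S ⊆ Finset.Icc (-(K' : ℤ)) K' ×ˢ (Finset.Icc (-(M : ℤ)) M ×ˢ Finset.Icc (-(M : ℤ)) M) := by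
    refine ⟨K + S.sup (fun w => w.1.natAbs),
      N + S.sup (fun w => w.2.1.natAbs) + S.sup (fun w => w.2.2.natAbs),
      Nat.le_add_right _ _, by omega, fun v hv => ?_⟩
    have e1 := Finset.le_sup (f := fun w : ℤ × ℤ × ℤ => w.1.natAbs) hv
    have e2 := Finset.le_sup (f := fun w : ℤ × ℤ × ℤ => w.2.1.natAbs) hv
    have e3 := Finset.le_sup (f := fun w : ℤ × ℤ × ℤ => w.2.2.natAbs) hv
    simp only [Finset.mem_product, Finset.mem_Icc]
    push_cast
    omega
  have step1 := Finset.sum_le_sum_of_subset_of_nonneg hS (fun v _ _ => hf0 v)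
  rw [Finset.sum_product] at step1
  -- layers `|k| ≤ K`
  have layer1 : ∀ k : ℤ, |k| ≤ (K : ℤ) →
      ∑ p ∈ Finset.Icc (-(M : ℤ)) M ×ˢ Finset.Icc (-(M : ℤ)) M, f (k, p) ≤
        4608 / (5 * ((3 * (N : ℝ) - 2) ^ 2 + 12 * (k : ℝ) ^ 2 * t ^ 2) ^ 2) := by
    intro k hk
    have h0 : ∑ p ∈ Finset.Icc (-(N : ℤ)) N ×ˢ Finset.Icc (-(N : ℤ)) N, f (k, p) ≤ 0 := by
      refine le_of_eq (Finset.sum_eq_zero fun p hp => ?_)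
      simp only [Finset.mem_product, Finset.mem_Icc] at hp
      exact hbox (k, p) hk (abs_le.2 hp.1) (abs_le.2 hp.2)
    have := powerSumTail_sum_square (fun p => f (k, p)) (12 * (k : ℝ) ^ 2 * t ^ 2) 0
      (by positivity) N hN h0 (fun m _ p e1 e2 e3 => hring k m p e1 e2 e3) M hNM
    linarith
  -- layers `|k| > K`
  have layer2 : ∀ k : ℤ, (K : ℤ) < |k| →
      ∑ p ∈ Finset.Icc (-(M : ℤ)) M ×ˢ Finset.Icc (-(M : ℤ)) M, f (k, p) ≤
        9 * (1 / t ^ 6) * (1 / (k : ℝ) ^ 6) + 32 / 5 * (1 / t ^ 4) * (1 / (k : ℝ) ^ 4) := by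
    intro k hk
    have hk0 : k ≠ 0 := by
      rintro rfl
      rw [abs_zero] at hk
      exact absurd hk (not_lt.2 (by positivity))
    have hkR : (k : ℝ) ≠ 0 := by exact_mod_cast hk0
    have hb : ∀ p ∈ Finset.Icc (-((1 : ℕ) : ℤ)) ((1 : ℕ) : ℤ) ×ˢ
        Finset.Icc (-((1 : ℕ) : ℤ)) ((1 : ℕ) : ℤ), f (k, p) ≤ 1 / t ^ 6 * (1 / (k : ℝ) ^ 6) := by
      intro p _
      calc f (k, p) ≤ 1 / ((k : ℝ) ^ 2 * t ^ 2) ^ 3 := hcentre k p hk0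
        _ = 1 / t ^ 6 * (1 / (k : ℝ) ^ 6) := by ring
    have hcard : (Finset.Icc (-((1 : ℕ) : ℤ)) ((1 : ℕ) : ℤ) ×ˢ
        Finset.Icc (-((1 : ℕ) : ℤ)) ((1 : ℕ) : ℤ)).card = 9 := by rfl
    have h0 := Finset.sum_le_card_nsmul _ _ _ hb
    rw [hcard, nsmul_eq_mul] at h0
    push_cast at h0
    have := powerSumTail_sum_square (fun p => f (k, p)) (12 * (k : ℝ) ^ 2 * t ^ 2)
      (9 * (1 / t ^ 6 * (1 / (k : ℝ) ^ 6))) (by positivity) 1 le_rfl (by linarith)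
      (fun m _ p e1 e2 e3 => hring k m p e1 e2 e3) M (hN.trans hNM)
    have e : 4608 / (5 * ((3 * ((1 : ℕ) : ℝ) - 2) ^ 2 + 12 * (k : ℝ) ^ 2 * t ^ 2) ^ 2) ≤
        32 / 5 * (1 / t ^ 4) * (1 / (k : ℝ) ^ 4) := by
      have e1 : (3 * ((1 : ℕ) : ℝ) - 2) ^ 2 = 1 := by norm_num
      have e2 : (32 : ℝ) / 5 * (1 / t ^ 4) * (1 / (k : ℝ) ^ 4) = 32 / (5 * t ^ 4 * k ^ 4) := by
        ring
      rw [e1, e2, div_le_div_iff₀ (by positivity) (by positivity)]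
      nlinarith [sq_nonneg ((k : ℝ) * t)]
    linarith
  -- sum the layers
  have main := powerSumTail_sum_layers
    (fun k => ∑ p ∈ Finset.Icc (-(M : ℤ)) M ×ˢ Finset.Icc (-(M : ℤ)) M, f (k, p))
    (fun k => 4608 / (5 * ((3 * (N : ℝ) - 2) ^ 2 + 12 * (k : ℝ) ^ 2 * t ^ 2) ^ 2))
    (32 / 5 * (1 / t ^ 4)) (9 * (1 / t ^ 6)) (by positivity) (by positivity) K hK layer1 layer2
    K' hKK'
  have e4 : 2 / 3 * (32 / 5 * (1 / t ^ 4)) * (1 / (K : ℝ) ^ 3) = 64 / (15 * K ^ 3 * t ^ 4) := by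
    ring
  have e6 : 2 / 5 * (9 * (1 / t ^ 6)) * (1 / (K : ℝ) ^ 5) = 18 / (5 * K ^ 5 * t ^ 6) := by ring
  linarith

/-! ## The registered stub -/

/-- **N5 `stub_powerSum_tail`.**  Explicit tail bound for the hcp power sum `P₃(t)`: with
`Q(k,i,j) = i² + ij + j² + [k odd](i + j + 1/3)`, `t > 0`, `K, N ≥ 1`, the sum of
`(Q v + k²t²)⁻³` over the sites `v ≠ 0` outside the index box `|k| ≤ K, |i|,|j| ≤ N` is at most
`∑_{|k| ≤ K} 4608/(5((3N-2)² + 12k²t²)²) + 64/(15K³t⁴) + 18/(5K⁵t⁶)`. [folklore] -/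
theorem stub_powerSum_tail :
    ∀ (Q : ℤ × ℤ × ℤ → ℝ),
    (Q = fun v => (v.2.1 : ℝ) ^ 2 + (v.2.1 : ℝ) * v.2.2 + (v.2.2 : ℝ) ^ 2 +
      (if Even v.1 then 0 else ((v.2.1 : ℝ) + v.2.2 + 1 / 3))) →
    ∀ (t : ℝ) (K N : ℕ), 0 < t → 1 ≤ K → 1 ≤ N →
      (∑' v : ℤ × ℤ × ℤ,
          if (|v.1| ≤ (K : ℤ) ∧ |v.2.1| ≤ (N : ℤ) ∧ |v.2.2| ≤ (N : ℤ)) then (0 : ℝ)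
          else if v = 0 then (0 : ℝ) else (((1 : ℝ) ^ 2 * Q v + (v.1 : ℝ) ^ 2 * t ^ 2)⁻¹) ^ 3) ≤
        (∑ k ∈ Finset.Icc (-(K : ℤ)) (K : ℤ),
            (4608 : ℝ) / (5 * ((3 * (N : ℝ) - 2) ^ 2 + 12 * (k : ℝ) ^ 2 * t ^ 2) ^ 2)) +
          64 / (15 * (K : ℝ) ^ 3 * t ^ 4) + 18 / (5 * (K : ℝ) ^ 5 * t ^ 6) := by
  intro Q hQ t K N ht hK hN
  have hQ0 : ∀ v, 0 ≤ Q v := by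
    intro v
    simp only [hQ]
    split_ifs
    · nlinarith [sq_nonneg ((v.2.1 : ℝ) + v.2.2 / 2), sq_nonneg (v.2.2 : ℝ)]
    · nlinarith [sq_nonneg ((v.2.1 : ℝ) + v.2.2 / 2 + 1 / 2), sq_nonneg ((v.2.2 : ℝ) + 1 / 3)]
  have hQring : ∀ (k : ℤ) (m : ℕ) (p : ℤ × ℤ), |p.1| ≤ (m : ℤ) + 1 → |p.2| ≤ (m : ℤ) + 1 →
      ((m : ℤ) + 1 ≤ |p.1| ∨ (m : ℤ) + 1 ≤ |p.2|) →
      (3 * ((m : ℝ) + 1) - 2) ^ 2 / 12 ≤ Q (k, p) := by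
    intro k m p e1 e2 e3
    obtain ⟨b1, b2⟩ := powerSumTail_ring_lb p.1 p.2 m e1 e2 e3
    simp only [hQ]
    split_ifs <;> linarith
  refine Real.tsum_le_of_sum_le (fun v => ?_) (fun S => ?_)
  · have := hQ0 v
    show (0 : ℝ) ≤ _
    split_ifs <;> positivity
  · refine powerSumTail_of_bounds _ t K N ht hK hN (fun v => ?_) (fun v e1 e2 e3 => ?_)
      (fun k m p e1 e2 e3 => ?_) (fun k p hk => ?_) S
    · have := hQ0 v
      split_ifs <;> positivity
    · rw [if_pos ⟨e1, e2, e3⟩]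
    · dsimp only
      have hm0 : (0 : ℝ) ≤ m := Nat.cast_nonneg m
      have hpos : 0 < (3 * ((m : ℝ) + 1) - 2) ^ 2 / 12 + (k : ℝ) ^ 2 * t ^ 2 :=
        add_pos_of_pos_of_nonneg (div_pos (by nlinarith) (by norm_num)) (by positivity)
      calc _ ≤ 1 / ((3 * ((m : ℝ) + 1) - 2) ^ 2 / 12 + (k : ℝ) ^ 2 * t ^ 2) ^ 3 :=
            powerSumTail_pt _ _ _ _ _ (hQring k m p e1 e2 e3) hpos
        _ = 1728 / ((3 * ((m : ℝ) + 1) - 2) ^ 2 + 12 * (k : ℝ) ^ 2 * t ^ 2) ^ 3 := by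
          rw [show (3 * ((m : ℝ) + 1) - 2) ^ 2 / 12 + (k : ℝ) ^ 2 * t ^ 2 =
            ((3 * ((m : ℝ) + 1) - 2) ^ 2 + 12 * (k : ℝ) ^ 2 * t ^ 2) / 12 by ring,
            div_pow, one_div_div]
          norm_num
    · dsimp only
      have hpos : (0 : ℝ) < 0 + (k : ℝ) ^ 2 * t ^ 2 := by
        have hkR : (k : ℝ) ≠ 0 := by exact_mod_cast hk
        rw [zero_add]; positivity
      calc _ ≤ 1 / (0 + (k : ℝ) ^ 2 * t ^ 2) ^ 3 := powerSumTail_pt _ _ _ _ _ (hQ0 _) hpos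
        _ = 1 / ((k : ℝ) ^ 2 * t ^ 2) ^ 3 := by rw [zero_add]

end Summit.AtomisticToContinuum.Crystallization.Theorems.LjBilayerHcpSketch
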